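import Summits.QuantumFields.YangMills.Theorems.FluctuationComparisonRegPrIntLS2BetaCovariantOscillationWalkSums
import Literature.MathematicalPhysics.QuantumFieldTheory.Balaban1983to89.BlockAveragingEMLProp2
import Literature.MathematicalPhysics.QuantumFieldTheory.Balaban1983to89.LatticeWordStokes
import HarnessLib

/-!
# S2β · (REG-UP) FILE A2 — «ONE STEP OF THE TOWER TRANSPORT OF THE COVARIANT OSCILLATION: THE LINEARISED AVERAGE» — the word-oscillation of the covariant linearised
# average `Q₁^{R₀}(U₀)Y` ([Balaban1985Averaging] (124)–(125), lit `covLinAvgR0`) at level `j+1`, in the transport of the AVERAGED background `Ū₀`, from the word-oscillation `c`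
# of `Y` at level `j`: per coarse step `c′ = 3·W(W+1+L)·c + 4θ·(3ℓ·M)`, `W = 3·d·⌊(L−1)∕2⌋ + L`, `ℓ = (d+2)L` (architect px17 g23 01:09:54Z (a); desk №705 (4))

Cell `ym3-torus` (YM ladder rung R3 = continuum `SU(2)` Yang–Mills on the three-torus at fixed lattice data — a RUNG: NOT d = 4, NOT infinite volume, NOT a mass gap,
NOT Clay).  Width seat `ym3-torus-px13` (gen 29); crux `stmt-QuantumFields-20520`, LINE g18-1 S2β, node (REG-UP).  `--kind proof --supports stmt-QuantumFields-20520 --as helper`,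
count-neutral, DEFINITION-FREE (0 `def`, 0 `instance`, 0 `notation`, 0 `sorry`, default heartbeats).  Torus side, level-generic `j`, `SU(N)`.

WHAT IS PROVED (sorry-free).
§1 ★`covLinAvgR0_eq_walkSums` — `Q₁^{R₀}(U₀)Y (c̄) = |I|⁻¹ Σ_i [ Y_{U₀}(walk y (Γᵢ ++ c)) − Y_{U₀}(walk y (Γᵢ ++ c ++ Γ′ᵢ⁻¹ ++ Γ′ᵢ)) + Y_{U₀}(walk y (Γᵢ ++ c ++ Γ′ᵢ⁻¹)) ]`, `y = emb c̄₋`: the three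
   `R₀`-form summands of (125) are covariant signed sums along EXPLICIT words from ONE base (`covWalkSum_append`, `holAt_walk_wordRev`, `walkEnd_stairWord_replicate`); word lengths
   `≤ W := 3·(d·⌊(L−1)∕2⌋) + L` (`length_walkWords_le`).
§2 ★`norm_conj_covLinAvgR0_translate_sub_le` — translating the base by one coarse step `L·e_μ` and transporting back by the straight-line holonomy costs `≤ 3·W·(W+1+L)·c` (FILE A1
   ✓`norm_conj_covWalkSum_translate_sub_le` ×3 per index, mean over `I`).
§3 ★★`covLinAvgR0_step_le` — THE COARSE ONE-STEP BOUND in the AVERAGED background's transport `Ū₀ = avgFun expMeanLogSU U₀` (`Ū₀(c̄) = κ(c̄)·U₀(line)`, lit `avgFun`∕`axialAvg_eq_holAt_walk`,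
   `dist1 κ ≤ 2θ` by ✓`dist1_corr_le_two_mul` under the loop guard `θ ≤ 1∕6`, `θ < δ_N`): `‖↑(Ū₀⟨ȳ,μ⟩)·(Q₁Y)⟨ȳ+e_μ, κ⟩·↑(Ū₀⟨ȳ,μ⟩)⋆ − (Q₁Y)⟨ȳ,κ⟩‖ ≤ 3·W·(W+1+L)·c + 4θ·(3·ℓ·M)`
   for `‖Y‖ ≤ M`; and ★★`covLinAvgR0_wordOsc` — the coarse word-oscillation `≤ |w̄|·c′` (FILE A1 ✓`wordOsc_of_step`).

HONEST.  Elementary re-basing of the lit linearised average; the loop guard, `‖Y‖ ≤ M` and the fine word-oscillation `c` are HYPOTHESES; nothing of Bałaban's analysis is proved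
([Balaban1985Averaging] Prop. 3∕4 (121)–(135) are the printed loci); the tower (FILE B), the operator defect `E` and the second-order remainder (D1∕C₆∕C₇), (RES-u), (L2-TOWER), GAP♯∘
(registry 3732b7df UNTOUCHED, 0∕5), S2β, crux 20520, 19936, 19200, `YM3TorusSU2` — NOT proved; rung R3 — NOT d = 4, NOT infinite volume, NOT a mass gap, NOT Clay; the Yang–Mills mass
gap is NOT proved.  Axioms standard.
-/

set_option autoImplicit false

noncomputable section

open scoped Matrix.Norms.L2Operator

namespace Summit.QuantumFields.YangMills.Theorems.FluctuationComparisonRegPrIntLS2BetaCovariantOscillationLinAvgStep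

open Literature.MathematicalPhysics.QuantumFieldTheory.Balaban1983to89
open T4Continuum (walk walkEnd holAt LStep holAt_nil holAt_cons Letter walk_append walkEnd_append holAt_append holAt_walk_wordRev walkEnd_walkEnd_wordRev wordRev
  stairWord walkEnd_replicate_L axialAvg_eq_holAt_walk)
open BlockAveraging (Idx off off_bounds avgFun loopHol corr)
open ExpMeanLog (expMeanLogSU deltaSU)
open BlockAveragingEMLProp2 (walkEnd_stairWord_replicate dist1_corr_le_two_mul)
open BlockAveragingEMLLinearisedBackground (covWalkSum covWalkSum_append covLinAvgR0 norm_covLinAvgR0_le)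
open LatticeWordStokes (length_stairWord_le)
open Summit.QuantumFields.YangMills.Theorems.FluctuationComparisonRegPrIntLS2BetaCovWalkSumStokes (norm_coe_conj_le norm_conj_sub_self_le)
open Summit.QuantumFields.YangMills.Theorems.FluctuationComparisonRegPrIntLS2BetaCovariantOscillationWalkSums

variable {P : Params} {j N : ℕ} [NeZero N]

/-! ## §1 The `R₀` form as three covariant walk sums from one base -/

section Words

variable (U₀ : GaugeField P j (Matrix.specialUnitaryGroup (Fin N) ℂ)) (Y : PBond P j → Matrix (Fin N) (Fin N) ℂ)

/-- `↑(𝒰(γ₁))·Y_{U₀}(γ₂)·↑(𝒰(γ₁))⋆ = Y_{U₀}(γ₁ ++ γ₂) − Y_{U₀}(γ₁)` (lit `covWalkSum_append`, rearranged). [cite: Balaban1985Averaging, (58) p.27] -/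
theorem conj_covWalkSum_eq_sub (γ₁ γ₂ : List (LStep P j)) :
    ((holAt U₀ γ₁ : Matrix.specialUnitaryGroup (Fin N) ℂ) : Matrix (Fin N) (Fin N) ℂ) * covWalkSum U₀ Y γ₂ * star ((holAt U₀ γ₁ : Matrix.specialUnitaryGroup (Fin N) ℂ) : Matrix (Fin N) (Fin N) ℂ) =
      covWalkSum U₀ Y (γ₁ ++ γ₂) - covWalkSum U₀ Y γ₁ := by
  rw [covWalkSum_append]; abel

/-- ★ **THE `R₀` FORM AS THREE WALK SUMS FROM `emb c̄₋`**: with `Γ = stairWord σ (off n)`, `Γ′ = stairWord σ′ (off n)`, `c = L` straight steps,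
`Q₁^{R₀}(U₀)Y (c̄) = |I|⁻¹ Σ_i [ Y_{U₀}(walk y (Γ ++ c)) − Y_{U₀}(walk y (Γ ++ c ++ Γ′⁻¹ ++ Γ′)) + Y_{U₀}(walk y (Γ ++ c ++ Γ′⁻¹)) ]`.
[cite: Balaban1985Averaging, (124)-(125) p.36] -/
theorem covLinAvgR0_eq_walkSums (c : PBond P (j + 1)) :
    covLinAvgR0 U₀ Y c = ((Fintype.card (Idx P) : ℂ))⁻¹ • ∑ i : Idx P,
      (covWalkSum U₀ Y (walk (emb c.src) (stairWord i.2.1 (off i.1) ++ List.replicate P.L (c.dir, true))) -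
        covWalkSum U₀ Y (walk (emb c.src) ((stairWord i.2.1 (off i.1) ++ List.replicate P.L (c.dir, true) ++ wordRev (stairWord i.2.2 (off i.1))) ++ stairWord i.2.2 (off i.1))) +
        covWalkSum U₀ Y (walk (emb c.src) (stairWord i.2.1 (off i.1) ++ List.replicate P.L (c.dir, true) ++ wordRev (stairWord i.2.2 (off i.1))))) := by
  unfold covLinAvgR0
  congr 1
  refine Finset.sum_congr rfl fun i _ => ?_
  set y : Site P j := emb c.src with hy
  set Γ : List (Letter P.d) := stairWord i.2.1 (off i.1) with hΓ
  set Γ' : List (Letter P.d) := stairWord i.2.2 (off i.1) with hΓ'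
  set ln : List (Letter P.d) := List.replicate P.L (c.dir, true) with hln
  set x : Site P j := walkEnd y Γ with hx
  -- geometry: the line from `x` ends where `Γ′` from `emb c₊` ends
  have hxe : walkEnd x ln = walkEnd (emb c.tgt) Γ' := by
    rw [hx, hy, hln, hΓ, hΓ']
    exact walkEnd_stairWord_replicate c.src c.dir i.2.1 i.2.2 (off i.1)
  have hend2 : walkEnd y (Γ ++ ln) = walkEnd (emb c.tgt) Γ' := by rw [walkEnd_append, ← hx, hxe]
  have hend3 : walkEnd y (Γ ++ ln ++ wordRev Γ') = emb c.tgt := by rw [walkEnd_append, hend2, walkEnd_walkEnd_wordRev]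
  -- the three holonomies of the `R₀` form as holonomies of walks from `y`
  have hA : holAt U₀ (walk y (Γ ++ ln)) = holAt U₀ (walk y Γ) * holAt U₀ (walk x ln) := by rw [walk_append, holAt_append]
  have hT : holAt U₀ (walk y (Γ ++ ln ++ wordRev Γ')) = holAt U₀ (walk y Γ) * holAt U₀ (walk x ln) * (holAt U₀ (walk (emb c.tgt) Γ'))⁻¹ := by
    rw [walk_append, holAt_append, hA, hend2, holAt_walk_wordRev]
  -- term 2: `A₀·S₂·A₀⋆ = Y(Γ ++ c) − Y(Γ)`
  have h2 : ((holAt U₀ (walk y Γ) : Matrix.specialUnitaryGroup (Fin N) ℂ) : Matrix (Fin N) (Fin N) ℂ) * covWalkSum U₀ Y (walk x ln) *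
      star ((holAt U₀ (walk y Γ) : Matrix.specialUnitaryGroup (Fin N) ℂ) : Matrix (Fin N) (Fin N) ℂ) = covWalkSum U₀ Y (walk y (Γ ++ ln)) - covWalkSum U₀ Y (walk y Γ) := by
    rw [conj_covWalkSum_eq_sub, ← walk_append]
  -- term 3: `T·S₃·T⋆ = Y(Γ ++ c ++ Γ′⁻¹ ++ Γ′) − Y(Γ ++ c ++ Γ′⁻¹)`
  have h3 : ((holAt U₀ (walk y Γ) * holAt U₀ (walk x ln) * (holAt U₀ (walk (emb c.tgt) Γ'))⁻¹ : Matrix.specialUnitaryGroup (Fin N) ℂ) : Matrix (Fin N) (Fin N) ℂ) *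
        covWalkSum U₀ Y (walk (emb c.tgt) Γ') *
      star ((holAt U₀ (walk y Γ) * holAt U₀ (walk x ln) * (holAt U₀ (walk (emb c.tgt) Γ'))⁻¹ : Matrix.specialUnitaryGroup (Fin N) ℂ) : Matrix (Fin N) (Fin N) ℂ) =
      covWalkSum U₀ Y (walk y ((Γ ++ ln ++ wordRev Γ') ++ Γ')) - covWalkSum U₀ Y (walk y (Γ ++ ln ++ wordRev Γ')) := by
    rw [← hT, conj_covWalkSum_eq_sub, ← hend3, ← walk_append]
  rw [h2, h3]
  abel

/-- The walk words of §1 have length at most `W = 3·(d·⌊(L−1)∕2⌋) + L`. [cite: Balaban1987RG1, (0.3) p.252] -/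
theorem length_walkWords_le (c : PBond P (j + 1)) (i : Idx P) :
    (stairWord i.2.1 (off i.1) ++ List.replicate P.L (c.dir, true)).length ≤ 3 * (P.d * ((P.L - 1) / 2)) + P.L ∧
    ((stairWord i.2.1 (off i.1) ++ List.replicate P.L (c.dir, true) ++ wordRev (stairWord i.2.2 (off i.1))) ++ stairWord i.2.2 (off i.1)).length ≤ 3 * (P.d * ((P.L - 1) / 2)) + P.L ∧
    (stairWord i.2.1 (off i.1) ++ List.replicate P.L (c.dir, true) ++ wordRev (stairWord i.2.2 (off i.1))).length ≤ 3 * (P.d * ((P.L - 1) / 2)) + P.L := by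
  have hN : ∀ ν, (off i.1 ν).natAbs ≤ (P.L - 1) / 2 := fun ν => by have h := off_bounds i.1 ν; omega
  have h₁ := length_stairWord_le i.2.1 (off i.1) _ hN
  have h₂ := length_stairWord_le i.2.2 (off i.1) _ hN
  have hrev : (wordRev (stairWord i.2.2 (off i.1))).length = (stairWord i.2.2 (off i.1)).length := by simp [wordRev]
  simp only [List.length_append, List.length_replicate, hrev]
  omega

end Words

/-! ## §2 Translating the base by one coarse step -/

section Translate

variable (U₀ : GaugeField P j (Matrix.specialUnitaryGroup (Fin N) ℂ)) (Y : PBond P j → Matrix (Fin N) (Fin N) ℂ)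

/-- ★ **ONE COARSE TRANSLATION OF THE LINEARISED AVERAGE**: for coarse bonds `c̄ = ⟨ȳ, κ⟩`, `c̄′ = ⟨ȳ + e_μ, κ⟩` and the straight-line holonomy `G = 𝒰(walk (emb ȳ) (L·e_μ))` (ending at
`emb (ȳ + e_μ)`), under the fine word-oscillation `c` of `Y`: `‖↑G·(Q₁^{R₀}Y)(c̄′)·↑G⋆ − (Q₁^{R₀}Y)(c̄)‖ ≤ 3·W·(W + 1 + L)·c`, `W = 3·(d·⌊(L−1)∕2⌋) + L`.
[cite: Balaban1985Averaging, (124)-(125) p.36, (58) p.27] -/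
theorem norm_conj_covLinAvgR0_translate_sub_le {c : ℝ} (hc : 0 ≤ c)
    (hw : ∀ (x : Site P j) (w : List (Letter P.d)) (κ : Fin P.d),
      ‖((holAt U₀ (walk x w) : Matrix.specialUnitaryGroup (Fin N) ℂ) : Matrix (Fin N) (Fin N) ℂ) * Y ⟨walkEnd x w, κ⟩ *
          star ((holAt U₀ (walk x w) : Matrix.specialUnitaryGroup (Fin N) ℂ) : Matrix (Fin N) (Fin N) ℂ) - Y ⟨x, κ⟩‖ ≤ (w.length : ℝ) * c)
    (y : Site P (j + 1)) (μ κ : Fin P.d) :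
    ‖((holAt U₀ (walk (emb y) (List.replicate P.L (μ, true))) : Matrix.specialUnitaryGroup (Fin N) ℂ) : Matrix (Fin N) (Fin N) ℂ) * covLinAvgR0 U₀ Y ⟨y.shift μ, κ⟩ *
        star ((holAt U₀ (walk (emb y) (List.replicate P.L (μ, true))) : Matrix.specialUnitaryGroup (Fin N) ℂ) : Matrix (Fin N) (Fin N) ℂ) - covLinAvgR0 U₀ Y ⟨y, κ⟩‖ ≤
      3 * ((3 * (P.d * ((P.L - 1) / 2)) + P.L : ℕ) : ℝ) * (((3 * (P.d * ((P.L - 1) / 2)) + P.L : ℕ) : ℝ) + 1 + P.L) * c := by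
  set Wn : ℕ := 3 * (P.d * ((P.L - 1) / 2)) + P.L with hWn
  set G : Matrix.specialUnitaryGroup (Fin N) ℂ := holAt U₀ (walk (emb y) (List.replicate P.L (μ, true))) with hG
  have hGend : walkEnd (emb y) (List.replicate P.L (μ, true)) = emb (y.shift μ) := walkEnd_replicate_L y μ
  -- the translation engine, for a word of length ≤ W
  have key : ∀ w : List (Letter P.d), w.length ≤ Wn →
      ‖(G : Matrix (Fin N) (Fin N) ℂ) * covWalkSum U₀ Y (walk (emb (y.shift μ)) w) * star (G : Matrix (Fin N) (Fin N) ℂ) - covWalkSum U₀ Y (walk (emb y) w)‖ ≤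
        (Wn : ℝ) * (((Wn : ℝ) + 1 + P.L) * c) := by
    intro w hwlen
    have h := norm_conj_covWalkSum_translate_sub_le U₀ Y hw w (List.replicate P.L (μ, true)) (emb y)
    rw [hGend, ← hG, List.length_replicate] at h
    refine h.trans ?_
    have hwl : (w.length : ℝ) ≤ Wn := by exact_mod_cast hwlen
    have hL : (0 : ℝ) ≤ P.L := Nat.cast_nonneg _
    have hw0 : (0 : ℝ) ≤ w.length := Nat.cast_nonneg _
    refine mul_le_mul hwl ?_ (by positivity) (by positivity)
    exact mul_le_mul_of_nonneg_right (by linarith) hc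
  rw [covLinAvgR0_eq_walkSums U₀ Y ⟨y.shift μ, κ⟩, covLinAvgR0_eq_walkSums U₀ Y ⟨y, κ⟩]
  simp only []
  -- pull the scalar and the sum through the conjugation
  rw [Matrix.mul_smul, Matrix.smul_mul, ← smul_sub, Finset.mul_sum, Finset.sum_mul, ← Finset.sum_sub_distrib]
  have hcard : ‖((Fintype.card (Idx P) : ℂ))⁻¹‖ = ((Fintype.card (Idx P) : ℝ))⁻¹ := by simp
  refine (norm_smul_le _ _).trans ?_
  rw [hcard]
  have hI : (0 : ℝ) < Fintype.card (Idx P) := by exact_mod_cast Fintype.card_pos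
  -- each index contributes at most `3·W·(W+1+L)·c`
  have hterm : ∀ i ∈ (Finset.univ : Finset (Idx P)),
      ‖(G : Matrix (Fin N) (Fin N) ℂ) *
          (covWalkSum U₀ Y (walk (emb (y.shift μ)) (stairWord i.2.1 (off i.1) ++ List.replicate P.L (κ, true))) -
            covWalkSum U₀ Y (walk (emb (y.shift μ)) ((stairWord i.2.1 (off i.1) ++ List.replicate P.L (κ, true) ++ wordRev (stairWord i.2.2 (off i.1))) ++ stairWord i.2.2 (off i.1))) +
            covWalkSum U₀ Y (walk (emb (y.shift μ)) (stairWord i.2.1 (off i.1) ++ List.replicate P.L (κ, true) ++ wordRev (stairWord i.2.2 (off i.1))))) *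
          star (G : Matrix (Fin N) (Fin N) ℂ) -
        (covWalkSum U₀ Y (walk (emb y) (stairWord i.2.1 (off i.1) ++ List.replicate P.L (κ, true))) -
            covWalkSum U₀ Y (walk (emb y) ((stairWord i.2.1 (off i.1) ++ List.replicate P.L (κ, true) ++ wordRev (stairWord i.2.2 (off i.1))) ++ stairWord i.2.2 (off i.1))) +
            covWalkSum U₀ Y (walk (emb y) (stairWord i.2.1 (off i.1) ++ List.replicate P.L (κ, true) ++ wordRev (stairWord i.2.2 (off i.1)))))‖ ≤
        3 * ((Wn : ℝ) * (((Wn : ℝ) + 1 + P.L) * c)) := by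
    intro i _
    obtain ⟨l1, l2, l3⟩ := length_walkWords_le (P := P) ⟨y, κ⟩ i
    have k1 := key _ l1
    have k2 := key _ l2
    have k3 := key _ l3
    have e : (G : Matrix (Fin N) (Fin N) ℂ) *
          (covWalkSum U₀ Y (walk (emb (y.shift μ)) (stairWord i.2.1 (off i.1) ++ List.replicate P.L (κ, true))) -
            covWalkSum U₀ Y (walk (emb (y.shift μ)) ((stairWord i.2.1 (off i.1) ++ List.replicate P.L (κ, true) ++ wordRev (stairWord i.2.2 (off i.1))) ++ stairWord i.2.2 (off i.1))) +
            covWalkSum U₀ Y (walk (emb (y.shift μ)) (stairWord i.2.1 (off i.1) ++ List.replicate P.L (κ, true) ++ wordRev (stairWord i.2.2 (off i.1))))) *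
          star (G : Matrix (Fin N) (Fin N) ℂ) -
        (covWalkSum U₀ Y (walk (emb y) (stairWord i.2.1 (off i.1) ++ List.replicate P.L (κ, true))) -
            covWalkSum U₀ Y (walk (emb y) ((stairWord i.2.1 (off i.1) ++ List.replicate P.L (κ, true) ++ wordRev (stairWord i.2.2 (off i.1))) ++ stairWord i.2.2 (off i.1))) +
            covWalkSum U₀ Y (walk (emb y) (stairWord i.2.1 (off i.1) ++ List.replicate P.L (κ, true) ++ wordRev (stairWord i.2.2 (off i.1))))) =
        ((G : Matrix (Fin N) (Fin N) ℂ) * covWalkSum U₀ Y (walk (emb (y.shift μ)) (stairWord i.2.1 (off i.1) ++ List.replicate P.L (κ, true))) * star (G : Matrix (Fin N) (Fin N) ℂ) -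
          covWalkSum U₀ Y (walk (emb y) (stairWord i.2.1 (off i.1) ++ List.replicate P.L (κ, true)))) -
        ((G : Matrix (Fin N) (Fin N) ℂ) * covWalkSum U₀ Y (walk (emb (y.shift μ)) ((stairWord i.2.1 (off i.1) ++ List.replicate P.L (κ, true) ++ wordRev (stairWord i.2.2 (off i.1))) ++ stairWord i.2.2 (off i.1))) * star (G : Matrix (Fin N) (Fin N) ℂ) -
          covWalkSum U₀ Y (walk (emb y) ((stairWord i.2.1 (off i.1) ++ List.replicate P.L (κ, true) ++ wordRev (stairWord i.2.2 (off i.1))) ++ stairWord i.2.2 (off i.1)))) +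
        ((G : Matrix (Fin N) (Fin N) ℂ) * covWalkSum U₀ Y (walk (emb (y.shift μ)) (stairWord i.2.1 (off i.1) ++ List.replicate P.L (κ, true) ++ wordRev (stairWord i.2.2 (off i.1)))) * star (G : Matrix (Fin N) (Fin N) ℂ) -
          covWalkSum U₀ Y (walk (emb y) (stairWord i.2.1 (off i.1) ++ List.replicate P.L (κ, true) ++ wordRev (stairWord i.2.2 (off i.1))))) := by
      noncomm_ring
    rw [e]
    refine (norm_add_le _ _).trans ((add_le_add ((norm_sub_le _ _).trans (add_le_add k1 k2)) k3).trans ?_)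
    linarith
  refine (mul_le_mul_of_nonneg_left (norm_sum_le_of_le _ hterm) (inv_nonneg.mpr hI.le)).trans ?_
  rw [Finset.sum_const, Finset.card_univ, nsmul_eq_mul, ← mul_assoc, inv_mul_cancel₀ hI.ne', one_mul]
  nlinarith [hc]

end Translate

/-! ## §3 ★★ The coarse one-step bound in the AVERAGED background's transport; the coarse word-oscillation -/

section Step

variable (U₀ : GaugeField P j (Matrix.specialUnitaryGroup (Fin N) ℂ)) (Y : PBond P j → Matrix (Fin N) (Fin N) ℂ)

/-- ★★ **THE COARSE ONE-STEP BOUND**: `Ū₀ = avgFun expMeanLogSU U₀` (`Ū₀(c̄) = κ(c̄)·U₀(line c̄)`), loop guard `dist1 (loopHol U₀ c̄ i) ≤ θ` (`θ ≤ 1∕6`, `θ < δ_N`), `‖Y‖ ≤ M`, fine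
word-oscillation `c`: `‖↑(Ū₀⟨ȳ,μ⟩)·(Q₁^{R₀}Y)⟨ȳ+e_μ,κ⟩·↑(Ū₀⟨ȳ,μ⟩)⋆ − (Q₁^{R₀}Y)⟨ȳ,κ⟩‖ ≤ 3·W·(W+1+L)·c + 4θ·(3·ℓ·M)`, `W = 3·(d·⌊(L−1)∕2⌋) + L`, `ℓ = (d+2)L`
(§2 + the correction factor's `2θ`-closeness to `1`, ✓`dist1_corr_le_two_mul`, on `‖Q₁Y‖ ≤ 3ℓM`, lit ✓`norm_covLinAvgR0_le`). [cite: Balaban1985Averaging, (124)-(125) p.36; Balaban1987RG1, (0.4) p.253] -/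
theorem covLinAvgR0_step_le {c M θ : ℝ} (hc : 0 ≤ c) (hM : ∀ b, ‖Y b‖ ≤ M)
    (hθ : ∀ (c' : PBond P (j + 1)) (i : Idx P), dist1 (loopHol U₀ c' i) ≤ θ) (hθδ : θ < deltaSU (Fin N)) (hθ6 : θ ≤ 1 / 6)
    (hw : ∀ (x : Site P j) (w : List (Letter P.d)) (κ : Fin P.d),
      ‖((holAt U₀ (walk x w) : Matrix.specialUnitaryGroup (Fin N) ℂ) : Matrix (Fin N) (Fin N) ℂ) * Y ⟨walkEnd x w, κ⟩ *
          star ((holAt U₀ (walk x w) : Matrix.specialUnitaryGroup (Fin N) ℂ) : Matrix (Fin N) (Fin N) ℂ) - Y ⟨x, κ⟩‖ ≤ (w.length : ℝ) * c)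
    (y : Site P (j + 1)) (μ κ : Fin P.d) :
    ‖((avgFun (expMeanLogSU (n := Fin N)) U₀ ⟨y, μ⟩ : Matrix.specialUnitaryGroup (Fin N) ℂ) : Matrix (Fin N) (Fin N) ℂ) * covLinAvgR0 U₀ Y ⟨y.shift μ, κ⟩ *
        star ((avgFun (expMeanLogSU (n := Fin N)) U₀ ⟨y, μ⟩ : Matrix.specialUnitaryGroup (Fin N) ℂ) : Matrix (Fin N) (Fin N) ℂ) - covLinAvgR0 U₀ Y ⟨y, κ⟩‖ ≤
      3 * ((3 * (P.d * ((P.L - 1) / 2)) + P.L : ℕ) : ℝ) * (((3 * (P.d * ((P.L - 1) / 2)) + P.L : ℕ) : ℝ) + 1 + P.L) * c +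
        4 * θ * (3 * ((((P.d + 2) * P.L : ℕ) : ℝ) * M)) := by
  set G : Matrix.specialUnitaryGroup (Fin N) ℂ := holAt U₀ (walk (emb y) (List.replicate P.L (μ, true))) with hG
  set kk : Matrix.specialUnitaryGroup (Fin N) ℂ := corr (expMeanLogSU (n := Fin N)) U₀ ⟨y, μ⟩ with hkk
  set Z' := covLinAvgR0 U₀ Y ⟨y.shift μ, κ⟩ with hZ'
  have havg : avgFun (expMeanLogSU (n := Fin N)) U₀ ⟨y, μ⟩ = kk * G := by
    rw [hkk, hG, avgFun, axialAvg_eq_holAt_walk]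
  have hkdist : dist1 kk ≤ 2 * θ := dist1_corr_le_two_mul U₀ ⟨y, μ⟩ (hθ ⟨y, μ⟩) hθδ hθ6
  have hZ'n : ‖Z'‖ ≤ 3 * ((((P.d + 2) * P.L : ℕ) : ℝ) * M) := norm_covLinAvgR0_le U₀ hM _
  have hθ0 : 0 ≤ θ := (GaugeGroup.dist1_nonneg _).trans (hθ ⟨y, μ⟩ (Classical.arbitrary _))
  -- split: `kG·Z′·(kG)⋆ − Z = (k·(GZ′G⋆)·k⋆ − GZ′G⋆) + (GZ′G⋆ − Z)`
  have e : ((kk * G : Matrix.specialUnitaryGroup (Fin N) ℂ) : Matrix (Fin N) (Fin N) ℂ) * Z' * star ((kk * G : Matrix.specialUnitaryGroup (Fin N) ℂ) : Matrix (Fin N) (Fin N) ℂ) -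
        covLinAvgR0 U₀ Y ⟨y, κ⟩ =
      ((kk : Matrix (Fin N) (Fin N) ℂ) * ((G : Matrix (Fin N) (Fin N) ℂ) * Z' * star (G : Matrix (Fin N) (Fin N) ℂ)) * star (kk : Matrix (Fin N) (Fin N) ℂ) -
          (G : Matrix (Fin N) (Fin N) ℂ) * Z' * star (G : Matrix (Fin N) (Fin N) ℂ)) +
        ((G : Matrix (Fin N) (Fin N) ℂ) * Z' * star (G : Matrix (Fin N) (Fin N) ℂ) - covLinAvgR0 U₀ Y ⟨y, κ⟩) := by
    rw [Submonoid.coe_mul, star_mul]; noncomm_ring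
  rw [havg, e]
  refine (norm_add_le _ _).trans ?_
  have h1 : ‖(kk : Matrix (Fin N) (Fin N) ℂ) * ((G : Matrix (Fin N) (Fin N) ℂ) * Z' * star (G : Matrix (Fin N) (Fin N) ℂ)) * star (kk : Matrix (Fin N) (Fin N) ℂ) -
      (G : Matrix (Fin N) (Fin N) ℂ) * Z' * star (G : Matrix (Fin N) (Fin N) ℂ)‖ ≤ 4 * θ * (3 * ((((P.d + 2) * P.L : ℕ) : ℝ) * M)) := by
    refine (norm_conj_sub_self_le kk _).trans ?_
    have hGZ : ‖(G : Matrix (Fin N) (Fin N) ℂ) * Z' * star (G : Matrix (Fin N) (Fin N) ℂ)‖ ≤ 3 * ((((P.d + 2) * P.L : ℕ) : ℝ) * M) := (norm_coe_conj_le G Z').trans hZ'n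
    have hd0 : 0 ≤ dist1 kk := GaugeGroup.dist1_nonneg _
    nlinarith [norm_nonneg ((G : Matrix (Fin N) (Fin N) ℂ) * Z' * star (G : Matrix (Fin N) (Fin N) ℂ))]
  have h2 := norm_conj_covLinAvgR0_translate_sub_le U₀ Y hc hw y μ κ
  rw [← hG, ← hZ'] at h2
  linarith

/-- ★★ **THE COARSE WORD-OSCILLATION OF THE LINEARISED AVERAGE** (FILE A1 ✓`wordOsc_of_step` at level `j+1` over the background `Ū₀`): for every coarse base `ȳ`, word `w̄`, direction `κ`:
`‖↑(𝒰_{Ū₀}(walk ȳ w̄))·(Q₁^{R₀}Y)⟨walkEnd ȳ w̄, κ⟩·(…)⋆ − (Q₁^{R₀}Y)⟨ȳ, κ⟩‖ ≤ |w̄|·(3·W·(W+1+L)·c + 4θ·(3ℓM))` — ONE STEP OF THE TOWER for the LINEAR part.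
[cite: Balaban1985Averaging, (124)-(125) p.36, Prop. 4 (128)-(131) pp.37-38] -/
theorem covLinAvgR0_wordOsc {c M θ : ℝ} (hc : 0 ≤ c) (hM : ∀ b, ‖Y b‖ ≤ M)
    (hθ : ∀ (c' : PBond P (j + 1)) (i : Idx P), dist1 (loopHol U₀ c' i) ≤ θ) (hθδ : θ < deltaSU (Fin N)) (hθ6 : θ ≤ 1 / 6)
    (hw : ∀ (x : Site P j) (w : List (Letter P.d)) (κ : Fin P.d),
      ‖((holAt U₀ (walk x w) : Matrix.specialUnitaryGroup (Fin N) ℂ) : Matrix (Fin N) (Fin N) ℂ) * Y ⟨walkEnd x w, κ⟩ *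
          star ((holAt U₀ (walk x w) : Matrix.specialUnitaryGroup (Fin N) ℂ) : Matrix (Fin N) (Fin N) ℂ) - Y ⟨x, κ⟩‖ ≤ (w.length : ℝ) * c)
    (ybar : Site P (j + 1)) (wbar : List (Letter P.d)) (κ : Fin P.d) :
    ‖((holAt (avgFun (expMeanLogSU (n := Fin N)) U₀) (walk ybar wbar) : Matrix.specialUnitaryGroup (Fin N) ℂ) : Matrix (Fin N) (Fin N) ℂ) *
          covLinAvgR0 U₀ Y ⟨walkEnd ybar wbar, κ⟩ *
        star ((holAt (avgFun (expMeanLogSU (n := Fin N)) U₀) (walk ybar wbar) : Matrix.specialUnitaryGroup (Fin N) ℂ) : Matrix (Fin N) (Fin N) ℂ) -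
        covLinAvgR0 U₀ Y ⟨ybar, κ⟩‖ ≤
      (wbar.length : ℝ) * (3 * ((3 * (P.d * ((P.L - 1) / 2)) + P.L : ℕ) : ℝ) * (((3 * (P.d * ((P.L - 1) / 2)) + P.L : ℕ) : ℝ) + 1 + P.L) * c +
        4 * θ * (3 * ((((P.d + 2) * P.L : ℕ) : ℝ) * M))) :=
  wordOsc_of_step (avgFun (expMeanLogSU (n := Fin N)) U₀) (fun b => covLinAvgR0 U₀ Y b)
    (fun x μ κ' => covLinAvgR0_step_le U₀ Y hc hM hθ hθδ hθ6 hw x μ κ') ybar wbar κ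

end Step

end Summit.QuantumFields.YangMills.Theorems.FluctuationComparisonRegPrIntLS2BetaCovariantOscillationLinAvgStep

end
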